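import Mathlib
import HarnessLib

/-!
# Route `RadicialJung`, crux `CleanModels` (stmt-ResolutionOfSingularities-15917), line `Sketch` rev 18, stub 4e
# `stub_cleanPrincipalization3`: toward L7b — the contact step, INTRINSIC form (no charts)

Memo `Cruxes/CleanModels/Lines/Sketch-memo-4e-cleanPermissible.md` §3 (phase 1), for the scheme-level typer of L7b (work plan W3): the
one-step bookkeeping of the contact between a regular curve `C` and a clean component `H = V(s)` under the blowing up of a closed point
`x ∈ C`, stated for an arbitrary ring map `φ : 𝒪 → 𝒪'` (the stalk map `𝒪_{X,x} → 𝒪_{X',x'}` at the point `x'` of the strict transform `C̃`),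
an element `e ∈ 𝒪'` (a local equation of the exceptional divisor), ideals `P ⊆ 𝒪` (of `C`) and `P' ⊆ 𝒪'` (of `C̃`) with `φ(P)𝒪' ⊆ e·P'`
(total transform = exceptional + strict), and `φ(w) = e·w₁` for the transversal coordinate `w` (`(P, w) = 𝔪_x`; `w₁` is a unit at the point
of `C̃`).  These three inputs are in the tree for transverse regular curves (`StrictTransformTransverseCurve.lean`,
`TransverseCentreEffectiveCartier.lean`, `BlowupOffCentre.lean`); here is only the algebra:

* `contact_step_intrinsic` — if `s = γ w^k + π`, `π ∈ P`, `k ≥ 1`, then `φ(s) = e · s₁` with `s₁ = φ(γ) w₁^k e^{k−1} + π₁`, `π₁ ∈ P'`, and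
  `φ(u w^A s^a) = (φ(u) w₁^A) · e^{A+a} · s₁^a` — the same shape one level up, contact `k − 1`, exceptional exponent `A + a`.
* `isUnit_contactZero_intrinsic` — at `k = 1` the new `s₁ = φ(γ) w₁ + π₁` is a unit as soon as `φ(γ) w₁` is a unit and `P' ⊆ 𝔪'`
  (`𝒪'` local): the clean component has left the curve.

Honest framing: OURS, elementary algebra; nothing here proves resolution in characteristic `p` or any case of `CleanModels`.
-/

noncomputable section

set_option linter.dupNamespace false -- mandated namespace of this single-conjunct summit

open IsLocalRing

namespace Summit.ResolutionOfSingularities.ResolutionOfSingularities.Theorems.RadicialJung.CleanModels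

/-- **The contact step, intrinsic form.**  See the module docstring. [cite: Piltant2013, §2 Axiom 4] -/
theorem contact_step_intrinsic {O O' : Type*} [CommRing O] [CommRing O'] (φ : O →+* O') (e w₁ : O') (P : Ideal O) (P' : Ideal O')
    (hPP' : P.map φ ≤ Ideal.span {e} * P') (w γ u π : O) (hw : φ w = e * w₁) (hπ : π ∈ P) (k : ℕ) (hk : 1 ≤ k) (A a : ℕ) :
    ∃ π₁ ∈ P', φ (γ * w ^ k + π) = e * (φ γ * w₁ ^ k * e ^ (k - 1) + π₁) ∧
      φ (u * w ^ A * (γ * w ^ k + π) ^ a) = (φ u * w₁ ^ A) * e ^ (A + a) * (φ γ * w₁ ^ k * e ^ (k - 1) + π₁) ^ a := by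
  have hφπ : φ π ∈ Ideal.span {e} * P' := hPP' (Ideal.mem_map_of_mem φ hπ)
  obtain ⟨π₁, hπ₁, hπ₁e⟩ := Ideal.mem_span_singleton_mul.mp hφπ
  obtain ⟨k', rfl⟩ := Nat.exists_eq_add_of_le hk
  refine ⟨π₁, hπ₁, ?_, ?_⟩
  · rw [map_add, map_mul, map_pow, hw, ← hπ₁e, Nat.add_sub_cancel_left, mul_pow, pow_add, pow_one, pow_add, pow_one]
    ring
  · rw [map_mul, map_mul, map_pow, map_pow, map_add, map_mul, map_pow, hw, ← hπ₁e, Nat.add_sub_cancel_left, mul_pow, mul_pow]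
    have : e ^ (1 + k') * w₁ ^ (1 + k') = e * (w₁ ^ (1 + k') * e ^ k') := by ring
    rw [show φ γ * (e ^ (1 + k') * w₁ ^ (1 + k')) + e * π₁ = e * (φ γ * w₁ ^ (1 + k') * e ^ k' + π₁) by rw [this]; ring,
      mul_pow, pow_add e A a]
    ring

/-- **Contact zero**: if `𝒪'` is local, `P' ⊆ 𝔪'`, and `φ(γ) w₁` is a unit, then `φ(γ) w₁^1 e^0 + π₁` is a unit for every `π₁ ∈ P'` — after the
last step of phase 1 the clean component `V(s₁)` no longer passes through the point of the curve. [folklore] -/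
theorem isUnit_contactZero_intrinsic {O' : Type*} [CommRing O'] [IsLocalRing O'] (g w₁ e : O') (P' : Ideal O')
    (hP' : P' ≤ maximalIdeal O') (hg : IsUnit (g * w₁)) {π₁ : O'} (hπ₁ : π₁ ∈ P') :
    IsUnit (g * w₁ ^ 1 * e ^ (1 - 1) + π₁) := by
  rw [pow_one, Nat.sub_self, pow_zero, mul_one]
  by_contra h
  have hm : g * w₁ + π₁ ∈ maximalIdeal O' := (mem_maximalIdeal _).mpr h
  have : g * w₁ ∈ maximalIdeal O' := by simpa using (maximalIdeal O').sub_mem hm (hP' hπ₁)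
  exact (mem_maximalIdeal _).mp this hg

end Summit.ResolutionOfSingularities.ResolutionOfSingularities.Theorems.RadicialJung.CleanModels

end
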